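import Summits.BirchSwinnertonDyer.Rank1Residual.X11b.IntSeriesValueRigidityOneSided
import Summits.BirchSwinnertonDyer.Rank1Residual.X11b.RouteR1LogOmega
import Summits.BirchSwinnertonDyer.BirchSwinnertonDyer.Theorems.ClassRecordThreeHalvesAtThreeBDPValue
import HarnessLib

/-!
# Route `ClassRecordThree`, crux `HalvesAtThree` (item stmt-BirchSwinnertonDyer-19107) — the H2 half
# `Three.BDPValueAt₃` from VALUE CONTINUITY AT `𝟙` alone (no `p`-adic `L`-function, no `R₀`-integrality
# in the hypothesis), and the certificate that this input is WEAKER than THEOREM C typed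

Cell `bsd-stepL` (run/shared/lean/pub/bsd-stepL/), seat `bsd-stepL-thmc-p1` (prover g2, D-0074 hands, 2026-08-26),
`--supports stmt-BirchSwinnertonDyer-19107` (route `route-BirchSwinnertonDyer-ClassRecordThree`, crux 3 =
`HalvesAtThree`). Sequel to `Theorems/ClassRecordThreeHalvesAtThreeBDPValue.lean` (g0: H2 ⟸ THEOREM C typed =
the frame-value statement `h12` of `Three.bdpValueAt₃_of_frameValue`: at every X11b@3 datum ONE `R₀`-integral
frame `(Ω_K, Ω_p, L ∈ R₀⟦T⟧)` with Castella's interpolation property AND the value at `𝟙`).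

## What this file records in the kernel

1. **H2@3 from value continuity (`bdpValueAt₃_of_valueContinuity`).** The ∀-frame H2 of record
   `Three.BDPValueAt₃ W` follows from the following FRAME-FREE statement (VC₃), stated INLINE (no definition):
   at every X11b@3 classical Heegner datum, every anticyclotomic `(κ, γ)`, every degree-one `𝔭 ∋ 3`, the newform
   `f` of `E` and every `ι' : ℚ̄₃ ≃ ℂ` inducing `𝔭`, there are "virtual periods" `Ω_K ∈ ℂ^×`, `Ω_p ∈ ℂ₃^×` and a
   unit `u ∈ R₀ˣ` such that CASTELLA'S DISPLAY `ι'⁻¹(bdpInterpolationValue 3 f 𝔭 φ_k n_k Ω_K)·Ω_p^{4 n_k}` — the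
   algebraic part of `L(f/K, φ_k, 1)` in Castella's normalisation, a COMPLEX special value read `3`-adically —
   tends to `u·((1 − a₃(E)·3⁻¹)·log_{ω_E} P)²` along EVERY interpolation sequence `(φ_k, n_k, r_k)` (`φ_k`
   everywhere unramified of infinity type `(n_k, −n_k)`, `n_k > 0`, `r_k` its `3`-adic avatar through `Γ⁻`)
   with `r_k(γ) → 1`. No power series, no Iwasawa algebra, no integrality is asked of the value side: (VC₃) is
   a statement about complex `L`-values and one `3`-adic logarithm. PROOF: given a frame `(Ω_K', Ω_p', L')`
   of `BDPValueAt₃`'s universal quantifier, read `L'` in `𝓞_{ℂ₃}⟦T⟧` (`R1.isBDPLFunctionInt_map`) and apply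
   the tree's ONE-SIDED ♭-rigidity `intSeries_constantCoeff_eq_of_isBDPLFunctionInt_of_continuousValues`
   (X11b/IntSeriesValueRigidityOneSided.lean, any odd `p`; its character supply is the THEOREM
   `exists_interpolationSupply_pow`): `[T⁰]L' = u·c²`; the limit is non-zero because `a₃(E) = ±1`
   (`Three.lFunction_eq_one_or_eq_neg_one_of_isNewformOf`) and `log_{ω_E} P ≠ 0` for non-torsion `P`
   (`R1.logOmega_ne_zero`). This is the `p ≥ 5` road's continuity currency
   (`P2.bdpValueSomeFrameOnTree_of_hsieh2014_of_continuousDisplay`, X11b/BDPRouteValueFromContinuity.lean)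
   run at `3` over the ∀-frame H2 of record.
2. **(VC₃) is WEAKER than THEOREM C typed (`valueContinuity₃_of_classicalFrameValue`).** THEOREM C's own
   frame supplies the virtual periods: its display values ARE the values of `L` at `r_k(γ) − 1 → 0`, which
   tend to `[T⁰]L = u·c²` (`intSeries_tendsto_value_of_tendsto_zero`). So the kernel chain is
   THEOREM C typed ⟹ (VC₃) ⟹ `Three.BDPValueAt₃ W`, refining g0's one-step reduction.
3. **Item level.** (VC₃) for every curve ⟹ the H2 stub of the crux on both loci
   (`classRecordThree_halvesAtThree_bdpValue_of_valueContinuity`); `HalvesAtThree` ⟸ (VC₃) ∧ the registered stub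
   `stub_imcDivAtThree` (`classRecordThree_halvesAtThree_of_valueContinuity_of_imcDivStub`); and g0's class-wide
   hypothesis `hC` (THEOREM C typed) implies the class-wide (VC₃) (`valueContinuity₃_classwide_of_classicalFrameValue`),
   so g0's reductions factor through these. So item 19107 is its one open half H3 `Three.IMCDivAt₃` modulo
   (VC₃) — an input that no longer contains the CONSTRUCTION of an integral `L_𝔭^{BDP}(f/K)` at `3 ∥ N`
   (W2-int), only the `3`-adic continuity at `𝟙` of normalised special values (W2-an-type content: in print
   for any `p` and any level at `𝔭` as Liu–Zhang–Zhang 2018 Thm. 3.8 ∕ 3.10 modulo the constants dictionary of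
   the cell memo PROOF-BDP §2 ∕ §20.3; at `p ∥ N`, `p ≥ 5` it is Castella JIMJ 2018 Thms. 2.10–2.11, a
   «continuous function» statement; at `3 ∥ N` with classical data it is PROOF-BDP §20 THEOREM C (C.3–C.5),
   a refereed MEMO theorem).

HONEST FRAMING: every theorem here is an implication; (VC₃) is NOT discharged, NOT a kernel theorem and NOT a
Literature fact; nothing is booked; no node, label or census count moves (T7); O2 stays OPEN; BSD(E,3) is proved
for no class by this file.

References: [Castella2018] Camb. J. Math. 6 (2018) = arXiv:1704.06608, Thm. 3.1–3.2 (pp. 8–9); [CastellaHsieh2018]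
Math. Ann. 370, §3.3, Def. 3.5, Prop. 3.6; [LiuZhangZhang2018] Duke Math. J. 167, Thm. 3.8, Thm. 3.10; Castella, J.
Inst. Math. Jussieu 17 (2018) = arXiv:1507.04260, Thms. 2.10–2.11; [Washington1997] §7.1; cell memo PROOF-BDP v1.8
§20 (THEOREM C, referee PASS `referee/VERDICT-THMC-g7.md`).
-/

noncomputable section

open scoped Classical Topology

open Filter WeierstrassCurve NumberField IsDedekindDomain Field PowerSeries
  Literature.NumberTheory.EllipticCurves Literature.NumberTheory.EllipticCurves.ModularForms
  Literature.NumberTheory.EllipticCurves.Rank1Residual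
  Literature.NumberTheory.GaloisRepresentations Literature.NumberTheory.GaloisCohomology
  Summit.BirchSwinnertonDyer.Rank1Residual Summit.BirchSwinnertonDyer.Rank1Residual.X11b
  Summit.BirchSwinnertonDyer.Rank1Residual.X11b.AcSelmer
  Summit.BirchSwinnertonDyer.Rank1Residual.X11b.CongruenceLimit
  Summit.BirchSwinnertonDyer.Rank1Residual.X11b.Halves
  Summit.BirchSwinnertonDyer.Rank1Residual.X11b.Three
  Summit.BirchSwinnertonDyer.BirchSwinnertonDyer.Theses.ClassRecordThree

namespace Summit.BirchSwinnertonDyer.BirchSwinnertonDyer.Theorems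

/-! ## §1 H2@3 from value continuity at `𝟙`, one curve at a time -/

section OneCurve

variable {W : WeierstrassCurve ℚ} [W.IsElliptic] [W.IsGloballyMinimal]

/-- **H2@3 from VALUE CONTINUITY AT `𝟙` (VC₃).** If at every X11b@3 classical datum and every `ι'` inducing `𝔭`
there are virtual periods `Ω_K ≠ 0`, `Ω_p ≠ 0` and `u ∈ R₀ˣ` such that Castella's display
`ι'⁻¹(bdpInterpolationValue 3 f 𝔭 φ_k n_k Ω_K)·Ω_p^{4n_k}` tends to `u·((1 − a₃(E)·3⁻¹)·log_{ω_E} P)²` along every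
interpolation sequence `(φ_k, n_k, r_k)` with `r_k(γ) → 1`, then the ∀-frame H2 of record `Three.BDPValueAt₃ W`
holds: EVERY frame `(Ω_K', Ω_p' ∈ R₀ˣ, L' ∈ R₀⟦T⟧)` with Castella's interpolation property has
`L'(0) = u·((1 − a₃·3⁻¹)·log_{ω_E} P)²`. One-sided ♭-rigidity
(`intSeries_constantCoeff_eq_of_isBDPLFunctionInt_of_continuousValues`) at the frame read in `𝓞_{ℂ₃}⟦T⟧`; the
limit is non-zero by `a₃ = ±1` and `log_{ω_E} P ≠ 0` (`P` non-torsion). The hypothesis carries NO `p`-adic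
`L`-function. CONDITIONAL on (VC₃), which is not in print at `3 ∥ N` (memo THEOREM C); nothing booked.
[cite: Castella2018, Thm. 3.1–3.2 (arXiv:1704.06608 pp. 8–9) (display and value shape only; nothing asserted at p = 3)] -/
theorem bdpValueAt₃_of_valueContinuity
    (hVC : ∀ (N : ℕ) [NeZero N] (K : Type) [Field K] [NumberField K] (Dt : ModularParametrizationData W N)
      (H : HeegnerDatum N (NumberField.discr K)) (ι : K →+* ℂ) (P : (W.baseChange K).toAffine.Point),
      ClassX11b W 3 → Surj W 3 → W.conductorNorm ℤ = N → IsImaginaryQuadratic K →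
      Odd (NumberField.discr K) → SatisfiesHeegnerHypothesis N K →
      (W.quadraticTwist (NumberField.discr K : ℚ)).entireLFunction 1 ≠ 0 →
      WeierstrassCurve.Affine.Point.map ι.toRatAlgHom P = heegnerPointComplex Dt H →
      ¬ (3 : ℤ) ∣ Dt.c → ¬ IsOfFinAddOrder P →
      ∀ (κ : ZpExtension K 3), κ.IsAnticyclotomic →
        ∀ (γ : Field.absoluteGaloisGroup K) [Fact (κ.IsTopGenerator γ)]
          (𝔭 : HeightOneSpectrum (𝓞 K)) (h𝔭 : ((3 : ℕ) : 𝓞 K) ∈ 𝔭.asIdeal)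
          (he : 𝔭.asIdeal.ramificationIdx (𝓞 ℚ) = 1) (hf : 𝔭.asIdeal.inertiaDeg (𝓞 ℚ) = 1),
          ∀ (f : CuspForm (CongruenceSubgroup.Gamma0 N) 2), IsNewformOf W f →
            ∀ (ι' : PadicAlgCl 3 ≃+* ℂ), InducesPrime ι' 𝔭 →
              ∃ (ΩK : ℂ) (Ωp : ℂ_[3]) (u : (unrIntegers 3)ˣ), ΩK ≠ 0 ∧ Ωp ≠ 0 ∧
                ∀ (φ : ℕ → HeckeCharacter K) (n : ℕ → ℕ) (r : ℕ → FramedGaloisRep K (PadicAlgCl 3) 1),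
                  (∀ k, 0 < n k) → (∀ k (v : HeightOneSpectrum (𝓞 K)), (φ k).IsUnramifiedAt v) →
                  (∀ k, (φ k).HasInfinityType (fun _ ↦ (n k : ℤ)) (fun _ ↦ -(n k : ℤ))) →
                  (∀ k, IsPAdicAvatarOf ι' (φ k) (r k)) → (∀ k, FactorsThroughZp κ (r k)) →
                  Tendsto (fun k ↦ avatarValueAt (r k) γ) atTop (𝓝 1) →
                  Tendsto (fun k ↦ ((ι'.symm (bdpInterpolationValue 3 f 𝔭 (φ k) (n k) ΩK) :
                    PadicAlgCl 3) : ℂ_[3]) * Ωp ^ (4 * n k)) atTop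
                    (𝓝 (((u : unrIntegers 3) : ℂ_[3]) *
                      (algebraMap ℚ_[3] ℂ_[3] (((1 : ℚ_[3]) - ((W.LFunction 3 : ℤ) : ℚ_[3]) *
                        (3 : ℚ_[3])⁻¹) * logOmega W 3 (embAt K 3 𝔭 h𝔭 he hf) P)) ^ 2))) :
    BDPValueAt₃ W := by
  intro N _ K _ _ Dt H ι P hX hsurj hN hK hodd hheeg hL1 hP hc hP0 κ hκ γ hγ 𝔭 h𝔭 he hf f hfW ι' hι'
    ΩK' Ωp' L' hΩK' hL'
  obtain ⟨ΩK, Ωp, u, hΩK, hΩp, hcont⟩ :=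
    hVC N K Dt H ι P hX hsurj hN hK hodd hheeg hL1 hP hc hP0 κ hκ γ 𝔭 h𝔭 he hf f hfW ι' hι'
  -- the would-be value `c = u·((1 − a₃·3⁻¹)·log_{ω_E} P)²` is non-zero
  have ha : W.LFunction 3 = 1 ∨ W.LFunction 3 = -1 :=
    lFunction_eq_one_or_eq_neg_one_of_isNewformOf W hfW hX.2.2.1
  have hx : ((1 : ℚ_[3]) - ((W.LFunction 3 : ℤ) : ℚ_[3]) * (3 : ℚ_[3])⁻¹) *
      logOmega W 3 (embAt K 3 𝔭 h𝔭 he hf) P ≠ 0 := by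
    refine mul_ne_zero ?_ (R1.logOmega_ne_zero W 3 (embAt K 3 𝔭 h𝔭 he hf) hP0)
    rcases ha with ha | ha <;> rw [ha] <;> norm_num
  have hu0 : ((u : unrIntegers 3) : ℂ_[3]) ≠ 0 := by
    rw [Ne, ZeroMemClass.coe_eq_zero]
    exact Units.ne_zero u
  have hc0 : ((u : unrIntegers 3) : ℂ_[3]) *
      (algebraMap ℚ_[3] ℂ_[3] (((1 : ℚ_[3]) - ((W.LFunction 3 : ℤ) : ℚ_[3]) * (3 : ℚ_[3])⁻¹) *
        logOmega W 3 (embAt K 3 𝔭 h𝔭 he hf) P)) ^ 2 ≠ 0 :=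
    mul_ne_zero hu0 (pow_ne_zero _ ((map_ne_zero_iff _ (algebraMap ℚ_[3] ℂ_[3]).injective).mpr hx))
  -- the given frame, read in `𝓞_{ℂ₃}⟦T⟧`
  have hΩp' : ((Ωp' : unrIntegers 3) : ℂ_[3]) ≠ 0 := by
    rw [Ne, ZeroMemClass.coe_eq_zero]
    exact Units.ne_zero Ωp'
  have hQ' := R1.isBDPLFunctionInt_map hL'
  have key := intSeries_constantCoeff_eq_of_isBDPLFunctionInt_of_continuousValues (p := 3) (by decide)
    hK hκ hγ.out hΩK hΩK' hΩp hΩp' hcont hc0 hQ'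
  have hcoe : ((PowerSeries.constantCoeff (PowerSeries.map (R1.unrToCpInt 3) L') : 𝓞_ℂ_[3]) : ℂ_[3]) =
      ((PowerSeries.constantCoeff L' : unrIntegers 3) : ℂ_[3]) := by
    rw [← PowerSeries.coeff_zero_eq_constantCoeff_apply, PowerSeries.coeff_map,
      PowerSeries.coeff_zero_eq_constantCoeff_apply, R1.coe_unrToCpInt]
  refine ⟨u, ?_⟩
  rw [← key, hcoe]
  exact L'.hasValueAt_zero

/-- **(VC₃) ⟸ THEOREM C typed, one curve**: the frame-value statement (`h12` of
`Three.bdpValueAt₃_of_frameValue`: ONE frame `(Ω_K, Ω_p ∈ R₀ˣ, L ∈ R₀⟦T⟧)` with interpolation AND value at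
`𝟙`) implies value continuity at `𝟙` — the frame's own periods serve as virtual periods, its display values
are the values of `L` at `r_k(γ) − 1 → 0`, and these tend to `[T⁰]L = u·((1 − a₃·3⁻¹)·log_{ω_E} P)²`
(`intSeries_tendsto_value_of_tendsto_zero`). Hence (VC₃) is WEAKER than THEOREM C typed. [folklore] -/
theorem valueContinuity₃_of_classicalFrameValue
    (h12 : ∀ (N : ℕ) [NeZero N] (K : Type) [Field K] [NumberField K] (Dt : ModularParametrizationData W N)
      (H : HeegnerDatum N (NumberField.discr K)) (ι : K →+* ℂ) (P : (W.baseChange K).toAffine.Point),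
      ClassX11b W 3 → Surj W 3 → W.conductorNorm ℤ = N → IsImaginaryQuadratic K →
      Odd (NumberField.discr K) → SatisfiesHeegnerHypothesis N K →
      (W.quadraticTwist (NumberField.discr K : ℚ)).entireLFunction 1 ≠ 0 →
      WeierstrassCurve.Affine.Point.map ι.toRatAlgHom P = heegnerPointComplex Dt H →
      ¬ (3 : ℤ) ∣ Dt.c → ¬ IsOfFinAddOrder P →
      ∀ (κ : ZpExtension K 3), κ.IsAnticyclotomic →
        ∀ (γ : Field.absoluteGaloisGroup K) [Fact (κ.IsTopGenerator γ)]
          (𝔭 : HeightOneSpectrum (𝓞 K)) (h𝔭 : ((3 : ℕ) : 𝓞 K) ∈ 𝔭.asIdeal)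
          (he : 𝔭.asIdeal.ramificationIdx (𝓞 ℚ) = 1) (hf : 𝔭.asIdeal.inertiaDeg (𝓞 ℚ) = 1),
          ∀ (f : CuspForm (CongruenceSubgroup.Gamma0 N) 2), IsNewformOf W f →
            ∀ (ι' : PadicAlgCl 3 ≃+* ℂ), InducesPrime ι' 𝔭 →
              ∃ (ΩK : ℂ) (Ωp : (unrIntegers 3)ˣ) (L : UnrSeries 3),
                ΩK ≠ 0 ∧ IsBDPLFunction ι' 𝔭 κ γ f ΩK ((Ωp : unrIntegers 3) : ℂ_[3]) L ∧
                ∃ u : (unrIntegers 3)ˣ, L.HasValueAt 0 (((u : unrIntegers 3) : ℂ_[3]) *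
                  (algebraMap ℚ_[3] ℂ_[3] (((1 : ℚ_[3]) - ((W.LFunction 3 : ℤ) : ℚ_[3]) * (3 : ℚ_[3])⁻¹) *
                    logOmega W 3 (embAt K 3 𝔭 h𝔭 he hf) P)) ^ 2)) :
    ∀ (N : ℕ) [NeZero N] (K : Type) [Field K] [NumberField K] (Dt : ModularParametrizationData W N)
      (H : HeegnerDatum N (NumberField.discr K)) (ι : K →+* ℂ) (P : (W.baseChange K).toAffine.Point),
      ClassX11b W 3 → Surj W 3 → W.conductorNorm ℤ = N → IsImaginaryQuadratic K →
      Odd (NumberField.discr K) → SatisfiesHeegnerHypothesis N K →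
      (W.quadraticTwist (NumberField.discr K : ℚ)).entireLFunction 1 ≠ 0 →
      WeierstrassCurve.Affine.Point.map ι.toRatAlgHom P = heegnerPointComplex Dt H →
      ¬ (3 : ℤ) ∣ Dt.c → ¬ IsOfFinAddOrder P →
      ∀ (κ : ZpExtension K 3), κ.IsAnticyclotomic →
        ∀ (γ : Field.absoluteGaloisGroup K) [Fact (κ.IsTopGenerator γ)]
          (𝔭 : HeightOneSpectrum (𝓞 K)) (h𝔭 : ((3 : ℕ) : 𝓞 K) ∈ 𝔭.asIdeal)
          (he : 𝔭.asIdeal.ramificationIdx (𝓞 ℚ) = 1) (hf : 𝔭.asIdeal.inertiaDeg (𝓞 ℚ) = 1),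
          ∀ (f : CuspForm (CongruenceSubgroup.Gamma0 N) 2), IsNewformOf W f →
            ∀ (ι' : PadicAlgCl 3 ≃+* ℂ), InducesPrime ι' 𝔭 →
              ∃ (ΩK : ℂ) (Ωp : ℂ_[3]) (u : (unrIntegers 3)ˣ), ΩK ≠ 0 ∧ Ωp ≠ 0 ∧
                ∀ (φ : ℕ → HeckeCharacter K) (n : ℕ → ℕ) (r : ℕ → FramedGaloisRep K (PadicAlgCl 3) 1),
                  (∀ k, 0 < n k) → (∀ k (v : HeightOneSpectrum (𝓞 K)), (φ k).IsUnramifiedAt v) →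
                  (∀ k, (φ k).HasInfinityType (fun _ ↦ (n k : ℤ)) (fun _ ↦ -(n k : ℤ))) →
                  (∀ k, IsPAdicAvatarOf ι' (φ k) (r k)) → (∀ k, FactorsThroughZp κ (r k)) →
                  Tendsto (fun k ↦ avatarValueAt (r k) γ) atTop (𝓝 1) →
                  Tendsto (fun k ↦ ((ι'.symm (bdpInterpolationValue 3 f 𝔭 (φ k) (n k) ΩK) :
                    PadicAlgCl 3) : ℂ_[3]) * Ωp ^ (4 * n k)) atTop
                    (𝓝 (((u : unrIntegers 3) : ℂ_[3]) *
                      (algebraMap ℚ_[3] ℂ_[3] (((1 : ℚ_[3]) - ((W.LFunction 3 : ℤ) : ℚ_[3]) *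
                        (3 : ℚ_[3])⁻¹) * logOmega W 3 (embAt K 3 𝔭 h𝔭 he hf) P)) ^ 2)) := by
  intro N _ K _ _ Dt H ι P hX hsurj hN hK hodd hheeg hL1 hP hc hP0 κ hκ γ _ 𝔭 h𝔭 he hf f hfW ι' hι'
  obtain ⟨ΩK, Ωp, L, hΩK, hL, u, hu⟩ :=
    h12 N K Dt H ι P hX hsurj hN hK hodd hheeg hL1 hP hc hP0 κ hκ γ 𝔭 h𝔭 he hf f hfW ι' hι'
  have hΩp : ((Ωp : unrIntegers 3) : ℂ_[3]) ≠ 0 := by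
    rw [Ne, ZeroMemClass.coe_eq_zero]
    exact Units.ne_zero Ωp
  refine ⟨ΩK, ((Ωp : unrIntegers 3) : ℂ_[3]), u, hΩK, hΩp, ?_⟩
  intro φ n r hn hunr hinf hr hrκ hlim
  -- the display values are the values of `L` at `r_k(γ) − 1`
  have hvals : ∀ k, IntSeries.HasValueAt (PowerSeries.map (R1.unrToCpInt 3) L)
      (avatarValueAt (r k) γ - 1)
      (((ι'.symm (bdpInterpolationValue 3 f 𝔭 (φ k) (n k) ΩK) : PadicAlgCl 3) : ℂ_[3]) *
        ((Ωp : unrIntegers 3) : ℂ_[3]) ^ (4 * n k)) := fun k ↦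
    (R1.intSeries_hasValueAt_map_iff 3 L _ _).mpr
      (hL (φ k) (n k) (hn k) (hunr k) (hinf k) (r k) (hr k) (hrκ k))
  have hT0 : Tendsto (fun k ↦ avatarValueAt (r k) γ - 1) atTop (𝓝 0) := by
    simpa using hlim.sub_const 1
  have hlimv := intSeries_tendsto_value_of_tendsto_zero hT0 hvals
  have hcoe : ((PowerSeries.constantCoeff (PowerSeries.map (R1.unrToCpInt 3) L) : 𝓞_ℂ_[3]) : ℂ_[3]) =
      ((PowerSeries.constantCoeff L : unrIntegers 3) : ℂ_[3]) := by
    rw [← PowerSeries.coeff_zero_eq_constantCoeff_apply, PowerSeries.coeff_map,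
      PowerSeries.coeff_zero_eq_constantCoeff_apply, R1.coe_unrToCpInt]
  rw [hcoe, ← UnrSeries.eq_constantCoeff_of_hasValueAt_zero hu] at hlimv
  exact hlimv

end OneCurve

/-! ## §2 (VC₃) for every curve ⟹ the H2 stub on both loci; the item reduced to its H3 stub

(VC₃) quantified over every curve (it binds `ClassX11b W 3 → Surj W 3` itself, so off X11b@3-with-surjective-image
it is empty) is the explicit hypothesis `hVC` of both theorems (stated INLINE — no definition). Not in print at
`3 ∥ N`; memo-level (PROOF-BDP §20 THEOREM C ⟹ it, §1 and §3); both theorems are conditional on it. -/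

/-- **(VC₃) for every curve ⟹ the H2 stub of crux `HalvesAtThree` on BOTH loci** — the conclusion is verbatim the
H2 conjuncts of the item's signature (the BC3 stub shape `stub_bdpValueAtThree`): for `E ∈ X11b` at 3, (ram) →
3 split → `BDPValueAt₃ W`, and ¬(ram) → surj → `BDPValueAt₃ W`. The loci binders are idle ((VC₃) gives H2 for every
X11b@3 curve with surjective image, §1; H2 is vacuous otherwise). CONDITIONAL on (VC₃).
[cite: Castella2018, Thm. 3.2 (arXiv:1704.06608 p. 9) (value shape only; antecedent = value continuity at 𝟙)] -/
theorem classRecordThree_halvesAtThree_bdpValue_of_valueContinuity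
    (hVC : ∀ (W : WeierstrassCurve ℚ) [W.IsElliptic] [W.IsGloballyMinimal],
      ∀ (N : ℕ) [NeZero N] (K : Type) [Field K] [NumberField K] (Dt : ModularParametrizationData W N)
      (H : HeegnerDatum N (NumberField.discr K)) (ι : K →+* ℂ) (P : (W.baseChange K).toAffine.Point),
      ClassX11b W 3 → Surj W 3 → W.conductorNorm ℤ = N → IsImaginaryQuadratic K →
      Odd (NumberField.discr K) → SatisfiesHeegnerHypothesis N K →
      (W.quadraticTwist (NumberField.discr K : ℚ)).entireLFunction 1 ≠ 0 →
      WeierstrassCurve.Affine.Point.map ι.toRatAlgHom P = heegnerPointComplex Dt H →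
      ¬ (3 : ℤ) ∣ Dt.c → ¬ IsOfFinAddOrder P →
      ∀ (κ : ZpExtension K 3), κ.IsAnticyclotomic →
        ∀ (γ : Field.absoluteGaloisGroup K) [Fact (κ.IsTopGenerator γ)]
          (𝔭 : HeightOneSpectrum (𝓞 K)) (h𝔭 : ((3 : ℕ) : 𝓞 K) ∈ 𝔭.asIdeal)
          (he : 𝔭.asIdeal.ramificationIdx (𝓞 ℚ) = 1) (hf : 𝔭.asIdeal.inertiaDeg (𝓞 ℚ) = 1),
          ∀ (f : CuspForm (CongruenceSubgroup.Gamma0 N) 2), IsNewformOf W f →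
            ∀ (ι' : PadicAlgCl 3 ≃+* ℂ), InducesPrime ι' 𝔭 →
              ∃ (ΩK : ℂ) (Ωp : ℂ_[3]) (u : (unrIntegers 3)ˣ), ΩK ≠ 0 ∧ Ωp ≠ 0 ∧
                ∀ (φ : ℕ → HeckeCharacter K) (n : ℕ → ℕ) (r : ℕ → FramedGaloisRep K (PadicAlgCl 3) 1),
                  (∀ k, 0 < n k) → (∀ k (v : HeightOneSpectrum (𝓞 K)), (φ k).IsUnramifiedAt v) →
                  (∀ k, (φ k).HasInfinityType (fun _ ↦ (n k : ℤ)) (fun _ ↦ -(n k : ℤ))) →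
                  (∀ k, IsPAdicAvatarOf ι' (φ k) (r k)) → (∀ k, FactorsThroughZp κ (r k)) →
                  Tendsto (fun k ↦ avatarValueAt (r k) γ) atTop (𝓝 1) →
                  Tendsto (fun k ↦ ((ι'.symm (bdpInterpolationValue 3 f 𝔭 (φ k) (n k) ΩK) :
                    PadicAlgCl 3) : ℂ_[3]) * Ωp ^ (4 * n k)) atTop
                    (𝓝 (((u : unrIntegers 3) : ℂ_[3]) *
                      (algebraMap ℚ_[3] ℂ_[3] (((1 : ℚ_[3]) - ((W.LFunction 3 : ℤ) : ℚ_[3]) *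
                        (3 : ℚ_[3])⁻¹) * logOmega W 3 (embAt K 3 𝔭 h𝔭 he hf) P)) ^ 2)))
    : ∀ (W : WeierstrassCurve ℚ) [W.IsElliptic] [W.IsGloballyMinimal],
      Summit.BirchSwinnertonDyer.Rank1Residual.ClassX11b W 3 →
        (Literature.NumberTheory.EllipticCurves.Rank1Residual.Ram W 3 →
            W.HasSplitMultiplicativeReductionAtPrime 3 →
              Summit.BirchSwinnertonDyer.Rank1Residual.X11b.Three.BDPValueAt₃ W) ∧
          (¬ Literature.NumberTheory.EllipticCurves.Rank1Residual.Ram W 3 →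
            Literature.NumberTheory.EllipticCurves.Rank1Residual.Surj W 3 →
              Summit.BirchSwinnertonDyer.Rank1Residual.X11b.Three.BDPValueAt₃ W) :=
  fun W _ _ _ ↦
    ⟨fun _ _ ↦ bdpValueAt₃_of_valueContinuity (hVC W), fun _ _ ↦ bdpValueAt₃_of_valueContinuity (hVC W)⟩

/-- **The item reduced to its registered H3 stub, modulo (VC₃).** `HalvesAtThree` follows from (VC₃) for every
curve and the two-loci H3 statement — verbatim the registered stub `stub_imcDivAtThree` of the BC3 skeleton v2
((ram) → 3 split → `IMCDivAt₃ W`; ¬(ram) → surj → `IMCDivAt₃ W`), i.e. the skeleton's composition with its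
frame-value stub WEAKENED to value continuity. H3 (`Three.IMCDivAt₃`, one inclusion of the anticyclotomic main
conjecture at `3 ∥ N` at the trivial character) is OPEN; nothing is discharged.
[cite: Castella2018, Thm. 3.3 (arXiv:1704.06608 p. 9) (shape of H3 only; open at p = 3)] -/
theorem classRecordThree_halvesAtThree_of_valueContinuity_of_imcDivStub
    (hVC : ∀ (W : WeierstrassCurve ℚ) [W.IsElliptic] [W.IsGloballyMinimal],
      ∀ (N : ℕ) [NeZero N] (K : Type) [Field K] [NumberField K] (Dt : ModularParametrizationData W N)
      (H : HeegnerDatum N (NumberField.discr K)) (ι : K →+* ℂ) (P : (W.baseChange K).toAffine.Point),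
      ClassX11b W 3 → Surj W 3 → W.conductorNorm ℤ = N → IsImaginaryQuadratic K →
      Odd (NumberField.discr K) → SatisfiesHeegnerHypothesis N K →
      (W.quadraticTwist (NumberField.discr K : ℚ)).entireLFunction 1 ≠ 0 →
      WeierstrassCurve.Affine.Point.map ι.toRatAlgHom P = heegnerPointComplex Dt H →
      ¬ (3 : ℤ) ∣ Dt.c → ¬ IsOfFinAddOrder P →
      ∀ (κ : ZpExtension K 3), κ.IsAnticyclotomic →
        ∀ (γ : Field.absoluteGaloisGroup K) [Fact (κ.IsTopGenerator γ)]
          (𝔭 : HeightOneSpectrum (𝓞 K)) (h𝔭 : ((3 : ℕ) : 𝓞 K) ∈ 𝔭.asIdeal)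
          (he : 𝔭.asIdeal.ramificationIdx (𝓞 ℚ) = 1) (hf : 𝔭.asIdeal.inertiaDeg (𝓞 ℚ) = 1),
          ∀ (f : CuspForm (CongruenceSubgroup.Gamma0 N) 2), IsNewformOf W f →
            ∀ (ι' : PadicAlgCl 3 ≃+* ℂ), InducesPrime ι' 𝔭 →
              ∃ (ΩK : ℂ) (Ωp : ℂ_[3]) (u : (unrIntegers 3)ˣ), ΩK ≠ 0 ∧ Ωp ≠ 0 ∧
                ∀ (φ : ℕ → HeckeCharacter K) (n : ℕ → ℕ) (r : ℕ → FramedGaloisRep K (PadicAlgCl 3) 1),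
                  (∀ k, 0 < n k) → (∀ k (v : HeightOneSpectrum (𝓞 K)), (φ k).IsUnramifiedAt v) →
                  (∀ k, (φ k).HasInfinityType (fun _ ↦ (n k : ℤ)) (fun _ ↦ -(n k : ℤ))) →
                  (∀ k, IsPAdicAvatarOf ι' (φ k) (r k)) → (∀ k, FactorsThroughZp κ (r k)) →
                  Tendsto (fun k ↦ avatarValueAt (r k) γ) atTop (𝓝 1) →
                  Tendsto (fun k ↦ ((ι'.symm (bdpInterpolationValue 3 f 𝔭 (φ k) (n k) ΩK) :
                    PadicAlgCl 3) : ℂ_[3]) * Ωp ^ (4 * n k)) atTop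
                    (𝓝 (((u : unrIntegers 3) : ℂ_[3]) *
                      (algebraMap ℚ_[3] ℂ_[3] (((1 : ℚ_[3]) - ((W.LFunction 3 : ℤ) : ℚ_[3]) *
                        (3 : ℚ_[3])⁻¹) * logOmega W 3 (embAt K 3 𝔭 h𝔭 he hf) P)) ^ 2)))
    (h3 : ∀ (W : WeierstrassCurve ℚ) [W.IsElliptic] [W.IsGloballyMinimal], ClassX11b W 3 →
      (Ram W 3 → W.HasSplitMultiplicativeReductionAtPrime 3 → IMCDivAt₃ W) ∧
        (¬ Ram W 3 → Surj W 3 → IMCDivAt₃ W)) :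
    HalvesAtThree := by
  unfold HalvesAtThree
  intro W _ _ hX
  obtain ⟨hI₁, hI₂⟩ := h3 W hX
  exact ⟨fun hr hs ↦ ⟨bdpValueAt₃_of_valueContinuity (hVC W), hI₁ hr hs⟩,
    fun hnr hsu ↦ ⟨bdpValueAt₃_of_valueContinuity (hVC W), hI₂ hnr hsu⟩⟩

/-! ## §3 THEOREM C typed ⟹ (VC₃), for every curve -/

/-- **THEOREM C typed class-wide ⟹ (VC₃) class-wide** (§1 `valueContinuity₃_of_classicalFrameValue` at every
curve): g0's hypothesis `hC` of `Theorems/ClassRecordThreeHalvesAtThreeBDPValue.lean` implies this file's `hVC`, so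
every reduction there factors through the ones here. [folklore] -/
theorem valueContinuity₃_classwide_of_classicalFrameValue
    (hC : ∀ (W : WeierstrassCurve ℚ) [W.IsElliptic] [W.IsGloballyMinimal],
      ∀ (N : ℕ) [NeZero N] (K : Type) [Field K] [NumberField K] (Dt : ModularParametrizationData W N)
      (H : HeegnerDatum N (NumberField.discr K)) (ι : K →+* ℂ) (P : (W.baseChange K).toAffine.Point),
      ClassX11b W 3 → Surj W 3 → W.conductorNorm ℤ = N → IsImaginaryQuadratic K →
      Odd (NumberField.discr K) → SatisfiesHeegnerHypothesis N K →
      (W.quadraticTwist (NumberField.discr K : ℚ)).entireLFunction 1 ≠ 0 →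
      WeierstrassCurve.Affine.Point.map ι.toRatAlgHom P = heegnerPointComplex Dt H →
      ¬ (3 : ℤ) ∣ Dt.c → ¬ IsOfFinAddOrder P →
      ∀ (κ : ZpExtension K 3), κ.IsAnticyclotomic →
        ∀ (γ : Field.absoluteGaloisGroup K) [Fact (κ.IsTopGenerator γ)]
          (𝔭 : HeightOneSpectrum (𝓞 K)) (h𝔭 : ((3 : ℕ) : 𝓞 K) ∈ 𝔭.asIdeal)
          (he : 𝔭.asIdeal.ramificationIdx (𝓞 ℚ) = 1) (hf : 𝔭.asIdeal.inertiaDeg (𝓞 ℚ) = 1),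
          ∀ (f : CuspForm (CongruenceSubgroup.Gamma0 N) 2), IsNewformOf W f →
            ∀ (ι' : PadicAlgCl 3 ≃+* ℂ), InducesPrime ι' 𝔭 →
              ∃ (ΩK : ℂ) (Ωp : (unrIntegers 3)ˣ) (L : UnrSeries 3),
                ΩK ≠ 0 ∧ IsBDPLFunction ι' 𝔭 κ γ f ΩK ((Ωp : unrIntegers 3) : ℂ_[3]) L ∧
                ∃ u : (unrIntegers 3)ˣ, L.HasValueAt 0 (((u : unrIntegers 3) : ℂ_[3]) *
                  (algebraMap ℚ_[3] ℂ_[3] (((1 : ℚ_[3]) - ((W.LFunction 3 : ℤ) : ℚ_[3]) * (3 : ℚ_[3])⁻¹) *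
                    logOmega W 3 (embAt K 3 𝔭 h𝔭 he hf) P)) ^ 2)) :
    ∀ (W : WeierstrassCurve ℚ) [W.IsElliptic] [W.IsGloballyMinimal],
    ∀ (N : ℕ) [NeZero N] (K : Type) [Field K] [NumberField K] (Dt : ModularParametrizationData W N)
      (H : HeegnerDatum N (NumberField.discr K)) (ι : K →+* ℂ) (P : (W.baseChange K).toAffine.Point),
      ClassX11b W 3 → Surj W 3 → W.conductorNorm ℤ = N → IsImaginaryQuadratic K →
      Odd (NumberField.discr K) → SatisfiesHeegnerHypothesis N K →
      (W.quadraticTwist (NumberField.discr K : ℚ)).entireLFunction 1 ≠ 0 →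
      WeierstrassCurve.Affine.Point.map ι.toRatAlgHom P = heegnerPointComplex Dt H →
      ¬ (3 : ℤ) ∣ Dt.c → ¬ IsOfFinAddOrder P →
      ∀ (κ : ZpExtension K 3), κ.IsAnticyclotomic →
        ∀ (γ : Field.absoluteGaloisGroup K) [Fact (κ.IsTopGenerator γ)]
          (𝔭 : HeightOneSpectrum (𝓞 K)) (h𝔭 : ((3 : ℕ) : 𝓞 K) ∈ 𝔭.asIdeal)
          (he : 𝔭.asIdeal.ramificationIdx (𝓞 ℚ) = 1) (hf : 𝔭.asIdeal.inertiaDeg (𝓞 ℚ) = 1),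
          ∀ (f : CuspForm (CongruenceSubgroup.Gamma0 N) 2), IsNewformOf W f →
            ∀ (ι' : PadicAlgCl 3 ≃+* ℂ), InducesPrime ι' 𝔭 →
              ∃ (ΩK : ℂ) (Ωp : ℂ_[3]) (u : (unrIntegers 3)ˣ), ΩK ≠ 0 ∧ Ωp ≠ 0 ∧
                ∀ (φ : ℕ → HeckeCharacter K) (n : ℕ → ℕ) (r : ℕ → FramedGaloisRep K (PadicAlgCl 3) 1),
                  (∀ k, 0 < n k) → (∀ k (v : HeightOneSpectrum (𝓞 K)), (φ k).IsUnramifiedAt v) →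
                  (∀ k, (φ k).HasInfinityType (fun _ ↦ (n k : ℤ)) (fun _ ↦ -(n k : ℤ))) →
                  (∀ k, IsPAdicAvatarOf ι' (φ k) (r k)) → (∀ k, FactorsThroughZp κ (r k)) →
                  Tendsto (fun k ↦ avatarValueAt (r k) γ) atTop (𝓝 1) →
                  Tendsto (fun k ↦ ((ι'.symm (bdpInterpolationValue 3 f 𝔭 (φ k) (n k) ΩK) :
                    PadicAlgCl 3) : ℂ_[3]) * Ωp ^ (4 * n k)) atTop
                    (𝓝 (((u : unrIntegers 3) : ℂ_[3]) *
                      (algebraMap ℚ_[3] ℂ_[3] (((1 : ℚ_[3]) - ((W.LFunction 3 : ℤ) : ℚ_[3]) *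
                        (3 : ℚ_[3])⁻¹) * logOmega W 3 (embAt K 3 𝔭 h𝔭 he hf) P)) ^ 2)) :=
  fun W _ _ ↦ valueContinuity₃_of_classicalFrameValue (hC W)

end Summit.BirchSwinnertonDyer.BirchSwinnertonDyer.Theorems

end
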